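import Literature.Barriers.CriticalPhenomena.SupercriticalSAWSpaceFillingSteps
import Literature.Barriers.CriticalPhenomena.SupercriticalSAWSpaceFillingFilaments
import Literature.Probability.RandomPlanarGeometry.SupercriticalSAWPolygons
import Mathlib.Data.Set.Finite.List
import HarnessLib

/-!
# Supercritical self-avoiding walks (Duminil-Copin–Kozma–Yadin 2014): the printed
# general-domain Theorem 6 fails for the disk with an outward cusp (machine-checked instance)

Companion of `SupercriticalSAWSpaceFilling.lean` (barrier `SupercriticalSAWSpaceFilling` =
Theorem 1 of H. Duminil-Copin, G. Kozma, A. Yadin, *Supercritical self-avoiding walks are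
space-filling*, Ann. IHP Probab. Stat. 50 (2014) 315–326, arXiv:1110.3074, for the unit disk —
PROVED in the tree, `SupercriticalSAWSpaceFilling_holds`) and of
`SupercriticalSAWSpaceFillingFilaments.lean` (dangling filaments are deterministic holes),
written by the barrier audit of 2026-08-15 (scope of the printed source). Nothing here bears on
Theorem 1 or on the disk instance `DKY2014_thm6_disk` (proved, `…TilesTheorem6.lean`): the file
shows that the GENERAL-DOMAIN form printed as Theorem 6 is over-stated.

## What the source prints (§3, p. 6–7)

* "To simplify the picture, we will assume that all our boxes have their lower left corner in
  `(2m+2)δℤ²`. When `Ω_δ` is fixed, such boxes included in `Ω_δ` are called `m`-boxes and the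
  set of `m`-boxes is denoted by `𝓕(Ω_δ, m)`." … "our only requirement from the domain is that
  the family of all boxes in `𝓕(Ω_δ, m)` is connected."
* **Theorem 6.** "For every `x > 1/μ`, there exists `m = m(x)` and `c(x) > 0` such that for
  every domain `Ω` and every `δ > 0` such that `𝓕(Ω_δ, m)` is connected, one has, for every `a`
  and `b` in the boundary of `Ω`, and every `λ > 0`,
  `P_{Ω_δ,a_δ,b_δ,x}(∃ a component of Ω_δ ∖ Γ_δ^{6m} of size > λ) ≤ (C(x,Ω)/δ²) e^{-c(x)λ}`."
* In its proof: "there must exist a connected family of at least `s/(2m+1)²` boxes of size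
  `2m+1` covering `S` and not intersecting `γ_δ`" and "`C(Ω) = C(Ω,x,m)` depends on the area
  of `Ω`, `x` and `m`"; and in §1 (p. 3) the caveat motivating the hypothesis: a "bridge" of
  width `δ` "does not leave the self-avoiding walk enough space to enter and exit. Thus an analog
  of theorem 1 will not hold for this `Ω`."

## What is proved here

For the fixed bounded open (simply connected) domain
`Ω = 𝔻 ∪ H`, `H = {1/2 < Re z < 2, |Im z| < (2 - Re z)²/10}` (`cuspDomain`: the unit disk with
an outward cusp ending at `2`; `isOpen_cuspDomain`, `isBounded_cuspDomain`):

* `meshDomain_cuspDomain`: `Ω_δ = Ω ∩ δℤ²` (the mesh vertex graph is connected: horn vertices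
  descend to the real axis inside `H`, the axis `[0, 2)` lies in `Ω`, disk vertices reach `0`);
  `reachable_discreteDomainGraph_cuspDomain`.
* `boxFamily_cuspDomain_preconnected`: **the hypothesis of Theorem 6 holds** — for
  `4(m+1)δ ≤ 1` the family `𝓕(Ω_δ, m) = boxFamily cuspDomain δ m` of all `m`-boxes of `Ω_δ`
  (grid `(2m+2)ℤ²`, `mBox`; adjacency of corners in `ℤ²`, as in `IsConnectedFamily`) is
  connected: every box slides through boxes of `Ω_δ` towards the real axis and then towards the
  imaginary axis (`mem_meshVertices_cuspDomain_of_dominated`: `Ω_δ` is stable under these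
  coordinate contractions) down to the base boxes `B(0,0) ∼ B(0,-1) ⊆ 𝔻_δ`.
* `cuspFil_neighbours`, `cuspFil_mem_meshDomain`, `cuspFil_adj`: the sites
  `f j = (k₀ - 1 + j, 0)`, `1 ≤ j ≤ N`, `k₀ = ⌈2/δ - √(10/δ)⌉`, `N = ⌈2/δ⌉ - k₀ > √(10/δ) - 1`,
  form a DANGLING FILAMENT of `Ω_δ` (beyond `k₀` the cusp is thinner than one mesh,
  `eq_axis_of_mem_meshVertices_cuspDomain`), and closest sites to points of the unit circle are
  off it (`IsClosestSite.apply_zero_lt_cuspK0`).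
* `hasLargeHole_cuspDomain`: hence (by `hasLargeHole_of_filament`) for `δ ≤ 1/20`,
  `δM² ≤ 4`, `ξ ≤ M`, EVERY self-avoiding walk of `Ω_δ` between closest sites to two points of
  the unit circle leaves a component of `Ω_δ ∖ Γ_δ^ξ` with more than `1/√δ` sites.
* `lawAt_cuspDomain_univ` (the law is a probability measure: finitely many SAWs,
  `finite_domainSAW_of_isBounded`, and at least one), `mem_frontier_cuspDomain` (`±i ∈ ∂Ω`),
  and the conclusion **`not_DKY2014_thm6_print_cuspDomain`**: for every `x > 0` there are no
  `m`, `ξ ≥ 0`, `c > 0`, `C` for which the displayed bound of Theorem 6 holds for `Ω` at all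
  meshes `δ` with `𝓕(Ω_δ, m)` connected, all boundary points, closest sites and `λ > 0` — at
  `δ = 1/t²`, `λ = t` the left side is `1` and the right side `C t⁴ e^{-ct} < 1`.

So "𝓕(Ω_δ, m) connected" does not control the sites of `Ω_δ` lying in no `m`-box, and the
covering sentence of the printed proof fails for them; what the proof needs (and what the
disk and the expanded domains `Ω + B(ξδ)` of Theorem 2 provide) is that every site of `Ω_δ` be
within bounded distance of a box of a connected box family. The barrier (Theorem 1, disk) is
untouched.

## References

* H. Duminil-Copin, G. Kozma, A. Yadin, *Supercritical self-avoiding walks are space-filling*,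
  Ann. Inst. Henri Poincaré Probab. Stat. 50 (2014) 315–326, arXiv:1110.3074: §1 p. 3 (bridges
  of width `δ`), §3 p. 6 (m-boxes, `𝓕(Ω_δ,m)`, Theorem 6), p. 7 (proof of Theorem 6).
  [DuminilCopinKozmaYadin2014]
-/

noncomputable section

open MeasureTheory Filter Topology Literature.Probability.LatticeModels Literature.Probability.Percolation Literature.Probability.RandomPlanarGeometry.SAW
open scoped ENNReal NNReal

namespace Literature.Barriers.CriticalPhenomena

namespace SupercriticalSAW

/-- The outward cusp `H = {1/2 < Re z < 2, |Im z| < (2 - Re z)²/10}`. [folklore] -/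
def cuspHorn : Set ℂ := {z | 1 / 2 < z.re ∧ z.re < 2 ∧ |z.im| < (2 - z.re) ^ 2 / 10}

/-- The disk with an outward cusp `Ω = 𝔻 ∪ H`. [folklore] -/
def cuspDomain : Set ℂ := unitDisk ∪ cuspHorn

/-- `𝔻 ⊆ Ω`. [folklore] -/
theorem unitDisk_subset_cuspDomain : unitDisk ⊆ cuspDomain := Set.subset_union_left

/-- Membership in the horn. [folklore] -/
theorem mem_cuspHorn_iff {z : ℂ} :
    z ∈ cuspHorn ↔ 1 / 2 < z.re ∧ z.re < 2 ∧ |z.im| < (2 - z.re) ^ 2 / 10 := Iff.rfl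

/-- Membership of a mesh point in the horn, in coordinates. [folklore] -/
theorem meshPoint_mem_cuspHorn_iff {δ : ℝ} {v : Site 2} :
    meshPoint δ v ∈ cuspHorn ↔
      1 / 2 < δ * v 0 ∧ δ * v 0 < 2 ∧ |δ * v 1| < (2 - δ * v 0) ^ 2 / 10 := by
  rw [mem_cuspHorn_iff, meshPoint_re, meshPoint_im]

/-- Mesh vertices of `Ω = 𝔻 ∪ H`: disk vertices or horn vertices. [folklore] -/
theorem mem_meshVertices_cuspDomain_iff {δ : ℝ} {v : Site 2} :
    v ∈ meshVertices cuspDomain δ ↔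
      v ∈ meshVertices unitDisk δ ∨ meshPoint δ v ∈ cuspHorn := by
  simp only [mem_meshVertices_iff, cuspDomain, Set.mem_union]

/-- The cusp domain is bounded (it lies in the ball of radius `3`). [folklore] -/
theorem isBounded_cuspDomain : Bornology.IsBounded cuspDomain := by
  refine (Metric.isBounded_ball (x := (0 : ℂ)) (r := 3)).subset ?_
  rintro z (hz | ⟨h1, h2, h3⟩)
  · exact Metric.ball_subset_ball (by norm_num) hz
  · rw [Metric.mem_ball, dist_zero_right]
    refine (Complex.norm_le_abs_re_add_abs_im z).trans_lt ?_
    have hre : |z.re| < 2 := abs_lt.2 ⟨by linarith, h2⟩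
    have him : |z.im| < 1 := by
      have : (2 - z.re) ^ 2 / 10 < 1 := by nlinarith
      linarith
    linarith

/-- The cusp domain is open. [folklore] -/
theorem isOpen_cuspDomain : IsOpen cuspDomain := by
  refine Metric.isOpen_ball.union ?_
  have h1 : IsOpen {z : ℂ | 1 / 2 < z.re} := isOpen_lt continuous_const Complex.continuous_re
  have h2 : IsOpen {z : ℂ | z.re < 2} := isOpen_lt Complex.continuous_re continuous_const
  have h3 : IsOpen {z : ℂ | |z.im| < (2 - z.re) ^ 2 / 10} :=
    isOpen_lt (continuous_abs.comp Complex.continuous_im) (by fun_prop)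
  have : cuspHorn = {z : ℂ | 1 / 2 < z.re} ∩ {z : ℂ | z.re < 2} ∩ {z : ℂ | |z.im| < (2 - z.re) ^ 2 / 10} := by
    ext z; simp [cuspHorn, and_assoc]
  rw [this]
  exact (h1.inter h2).inter h3

/-- Points of the real segment `[0, 2)` lie in the cusp domain. [folklore] -/
theorem ofReal_mem_cuspDomain {t : ℝ} (h0 : 0 ≤ t) (h2 : t < 2) : (t : ℂ) ∈ cuspDomain := by
  rcases le_or_gt t (1 / 2) with ht | ht
  · left
    rw [unitDisk, mem_ball_zero_iff, Complex.norm_real, Real.norm_eq_abs, abs_of_nonneg h0]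
    linarith
  · right
    refine ⟨by simpa using ht, by simpa using h2, ?_⟩
    simp only [Complex.ofReal_im, abs_zero, Complex.ofReal_re]
    have : 0 < 2 - t := by linarith
    positivity

/-- A vertical step inside the horn: if `(x, y)` is in `H` and `|y'| ≤ |y|` then the whole
vertical segment from `(x, y')` to `(x, y)` is in `H`. [folklore] -/
theorem segment_subset_cuspHorn_of_im {x y y' : ℝ} (h : (⟨x, y⟩ : ℂ) ∈ cuspHorn)
    (hy : |y'| ≤ |y|) : segment ℝ (⟨x, y'⟩ : ℂ) ⟨x, y⟩ ⊆ cuspHorn := by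
  obtain ⟨h1, h2, h3⟩ := h
  simp only at h1 h2 h3
  rw [segment_eq_image]
  rintro z ⟨t, ⟨ht0, ht1⟩, rfl⟩
  refine ⟨?_, ?_, ?_⟩
  · simp; linarith
  · simp; linarith
  · simp only [Complex.add_im, Complex.smul_im, smul_eq_mul, Complex.add_re, Complex.smul_re]
    have hre : (1 - t) * x + t * x = x := by ring
    rw [hre]
    calc |(1 - t) * y' + t * y| ≤ |(1 - t) * y'| + |t * y| := abs_add_le _ _
      _ = (1 - t) * |y'| + t * |y| := by
          rw [abs_mul, abs_mul, abs_of_nonneg (by linarith), abs_of_nonneg ht0]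
      _ ≤ (1 - t) * |y| + t * |y| := by nlinarith
      _ = |y| := by ring
      _ < (2 - x) ^ 2 / 10 := h3


/-! ### `Ω_δ` for the cusp domain: every mesh vertex is joined to the origin -/

/-- A mesh point as a complex number with its two coordinates. [folklore] -/
theorem meshPoint_eq_mk (δ : ℝ) (v : Site 2) : meshPoint δ v = ⟨δ * v 0, δ * v 1⟩ :=
  Complex.ext (by simp) (by simp)

/-- Mesh points of sites on the real axis are real. [folklore] -/
theorem meshPoint_axis (δ : ℝ) (x : ℤ) : meshPoint δ ![x, 0] = ((δ * x : ℝ) : ℂ) :=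
  Complex.ext (by simp) (by simp)

/-- The mesh graph is monotone in the domain. [folklore] -/
theorem meshGraph_mono {Ω Ω' : Set ℂ} (h : Ω ⊆ Ω') (δ : ℝ) : meshGraph Ω δ ≤ meshGraph Ω' δ :=
  fun _ _ hxy => meshGraph_adj_iff.2 ⟨(meshGraph_adj_iff.1 hxy).1,
    (meshGraph_adj_iff.1 hxy).2.trans (closure_mono h)⟩

/-- Mesh vertices are monotone in the domain. [folklore] -/
theorem meshVertices_mono {Ω Ω' : Set ℂ} (h : Ω ⊆ Ω') (δ : ℝ) :
    meshVertices Ω δ ⊆ meshVertices Ω' δ := fun _ hv => h hv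

/-- Reachability in the mesh vertex graph passes to a larger domain. [folklore] -/
theorem meshVertexGraph_reachable_mono {Ω Ω' : Set ℂ} (h : Ω ⊆ Ω') (δ : ℝ)
    {u v : Site 2} (hu : u ∈ meshVertices Ω δ) (hv : v ∈ meshVertices Ω δ)
    (hr : (meshVertexGraph Ω δ).Reachable ⟨u, hu⟩ ⟨v, hv⟩) :
    (meshVertexGraph Ω' δ).Reachable ⟨u, meshVertices_mono h δ hu⟩
      ⟨v, meshVertices_mono h δ hv⟩ := by
  let φ : meshVertexGraph Ω δ →g meshVertexGraph Ω' δ :=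
    { toFun := fun w => ⟨w.1, meshVertices_mono h δ w.2⟩
      map_rel' := fun hab => SimpleGraph.induce_adj.2 (meshGraph_mono h δ (SimpleGraph.induce_adj.1 hab)) }
  exact hr.map φ

/-- Sites `(x, 0)` with `0 ≤ δx < 2` are mesh vertices of the cusp domain. [folklore] -/
theorem axis_mem_meshVertices_cuspDomain {δ : ℝ} {x : ℤ} (h0 : 0 ≤ δ * x) (h2 : δ * x < 2) :
    (![x, 0] : Site 2) ∈ meshVertices cuspDomain δ := by
  rw [mem_meshVertices_iff, meshPoint_axis]
  exact ofReal_mem_cuspDomain h0 h2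

/-- Consecutive axis sites `(x - 1, 0) ∼ (x, 0)` with `0 ≤ δ(x-1)`, `δx < 2` are joined in the
mesh graph of the cusp domain (the segment between them lies on `[0, 2) ⊆ Ω`). [folklore] -/
theorem meshGraph_cuspDomain_adj_axis {δ : ℝ} (hδ : 0 < δ) {x : ℤ} (h0 : 0 ≤ δ * (x - 1))
    (h2 : δ * x < 2) : (meshGraph cuspDomain δ).Adj ![x - 1, 0] ![x, 0] := by
  refine meshGraph_adj_iff.2 ⟨(zdGraph_adj_iff _ _).2 ⟨0, Or.inl ?_⟩, ?_⟩
  · funext i; fin_cases i <;> simp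
  · rw [segment_eq_image]
    rintro z ⟨t, ⟨ht0, ht1⟩, rfl⟩
    apply subset_closure
    have hx1 : ((x - 1 : ℤ) : ℝ) = (x : ℝ) - 1 := by push_cast; ring
    rw [meshPoint_axis, meshPoint_axis, hx1]
    have : (1 - t) • (((δ * ((x : ℝ) - 1) : ℝ) : ℂ)) + t • (((δ * x : ℝ) : ℂ)) =
        (((1 - t) * (δ * ((x : ℝ) - 1)) + t * (δ * x) : ℝ) : ℂ) := by
      push_cast; simp [Complex.real_smul]
    show (1 - t) • (((δ * ((x : ℝ) - 1) : ℝ) : ℂ)) + t • (((δ * x : ℝ) : ℂ)) ∈ cuspDomain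
    rw [this]
    have hδx : 0 ≤ δ * (x : ℝ) := by nlinarith
    apply ofReal_mem_cuspDomain
    · nlinarith [mul_nonneg (sub_nonneg.2 ht1) h0, mul_nonneg ht0 hδx]
    · nlinarith [mul_nonneg (sub_nonneg.2 ht1) h0, mul_nonneg ht0 hδx]

/-- Axis sites `(x, 0)`, `0 ≤ x`, `δx < 2`, reach the origin in the mesh vertex graph of the cusp
domain. [folklore] -/
theorem reachable_zero_of_axis {δ : ℝ} (hδ : 0 < δ) :
    ∀ (n : ℕ) (x : ℤ) (hx0 : 0 ≤ x) (hx2 : δ * x < 2), x.toNat = n →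
      (meshVertexGraph cuspDomain δ).Reachable
        ⟨![x, 0], axis_mem_meshVertices_cuspDomain (by positivity) hx2⟩
        ⟨0, meshVertices_mono unitDisk_subset_cuspDomain δ (zero_mem_meshVertices_unitDisk δ)⟩ := by
  intro n
  induction n with
  | zero =>
    intro x hx0 hx2 hn
    have hx : x = 0 := by omega
    subst hx
    have : (![0, 0] : Site 2) = 0 := by funext i; fin_cases i <;> rfl
    simp only [this]
    rfl
  | succ n ih =>
    intro x hx0 hx2 hn
    have hx1 : 0 ≤ x - 1 := by omega
    have hx2' : δ * ((x - 1 : ℤ) : ℝ) < 2 := by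
      have : ((x - 1 : ℤ) : ℝ) ≤ x := by push_cast; linarith
      nlinarith
    have hx1r : (0 : ℝ) ≤ (x : ℝ) - 1 := by
      have := (Int.cast_le (R := ℝ)).2 hx1; push_cast at this; linarith
    have hadj := meshGraph_cuspDomain_adj_axis hδ (x := x) (mul_nonneg hδ.le hx1r) hx2
    have h1 := ih (x - 1) hx1 hx2' (by omega)
    have hadj' : (meshVertexGraph cuspDomain δ).Adj
        ⟨![x, 0], axis_mem_meshVertices_cuspDomain (by positivity) hx2⟩
        ⟨![x - 1, 0], axis_mem_meshVertices_cuspDomain (by positivity) hx2'⟩ :=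
      SimpleGraph.induce_adj.2 hadj.symm
    exact hadj'.reachable.trans h1

/-- Horn vertices reach the axis site below them in the mesh vertex graph of the cusp domain
(vertical steps towards the real axis stay inside the horn). [folklore] -/
theorem reachable_axis_of_horn {δ : ℝ} (hδ : 0 < δ) :
    ∀ (n : ℕ) (v : Site 2) (hv : meshPoint δ v ∈ cuspHorn), (v 1).natAbs = n →
      ∃ h0 : (![v 0, 0] : Site 2) ∈ meshVertices cuspDomain δ,
        (meshVertexGraph cuspDomain δ).Reachable ⟨v, Or.inr hv⟩ ⟨![v 0, 0], h0⟩ := by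
  intro n
  induction n with
  | zero =>
    intro v hv hn
    have hv1 : v 1 = 0 := Int.natAbs_eq_zero.1 hn
    have e : (![v 0, 0] : Site 2) = v := by funext i; fin_cases i <;> simp [hv1]
    have h0 : (![v 0, 0] : Site 2) ∈ meshVertices cuspDomain δ := by rw [e]; exact Or.inr hv
    refine ⟨h0, ?_⟩
    have : (⟨![v 0, 0], h0⟩ : ↥(meshVertices cuspDomain δ)) = ⟨v, Or.inr hv⟩ := Subtype.ext e
    rw [this]
  | succ n ih =>
    intro v hv hn
    obtain ⟨w, hadj, habs, hw⟩ := exists_step_towards_zero v 1 (by intro h; rw [h] at hn; simp at hn)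
    have hw0 : w 0 = v 0 := hw 0 (by decide)
    have hwabs : |(w 1 : ℝ)| ≤ |(v 1 : ℝ)| := by
      have h1 : ((w 1).natAbs : ℤ) ≤ (v 1).natAbs := by omega
      have h2 : |w 1| ≤ |v 1| := by simpa [Int.natCast_natAbs] using h1
      exact_mod_cast h2
    have hwH : meshPoint δ w ∈ cuspHorn := by
      rw [meshPoint_mem_cuspHorn_iff] at hv ⊢
      rw [hw0]
      refine ⟨hv.1, hv.2.1, lt_of_le_of_lt ?_ hv.2.2⟩
      rw [abs_mul, abs_mul, abs_of_pos hδ]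
      exact mul_le_mul_of_nonneg_left hwabs hδ.le
    obtain ⟨h0, hreach⟩ := ih w hwH (by omega)
    have hseg : segment ℝ (meshPoint δ w) (meshPoint δ v) ⊆ cuspHorn := by
      rw [meshPoint_eq_mk, meshPoint_eq_mk, hw0]
      apply segment_subset_cuspHorn_of_im
      · rw [← meshPoint_eq_mk]; exact hv
      · rw [abs_mul, abs_mul, abs_of_pos hδ]
        exact mul_le_mul_of_nonneg_left hwabs hδ.le
    have hadj' : (meshVertexGraph cuspDomain δ).Adj ⟨v, Or.inr hv⟩ ⟨w, Or.inr hwH⟩ := by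
      refine SimpleGraph.induce_adj.2 (meshGraph_adj_iff.2 ⟨hadj, ?_⟩)
      rw [segment_symm]
      exact hseg.trans ((Set.subset_union_right).trans subset_closure)
    refine ⟨hw0 ▸ h0, hadj'.reachable.trans ?_⟩
    convert hreach using 2; simp [hw0]

/-- Every mesh vertex of the cusp domain is joined to the origin in its mesh vertex graph.
[folklore] -/
theorem meshVertexGraph_cuspDomain_reachable_zero {δ : ℝ} (hδ : 0 < δ) (v : Site 2)
    (hv : v ∈ meshVertices cuspDomain δ) :
    (meshVertexGraph cuspDomain δ).Reachable ⟨v, hv⟩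
      ⟨0, meshVertices_mono unitDisk_subset_cuspDomain δ (zero_mem_meshVertices_unitDisk δ)⟩ := by
  rcases mem_meshVertices_cuspDomain_iff.1 hv with hD | hH
  · exact meshVertexGraph_reachable_mono unitDisk_subset_cuspDomain δ hD
      (zero_mem_meshVertices_unitDisk δ) (meshVertexGraph_unitDisk_reachable_zero v hD)
  · obtain ⟨h0, h1⟩ := reachable_axis_of_horn hδ _ v hH rfl
    have hb := (meshPoint_mem_cuspHorn_iff.1 hH)
    have hx0 : 0 ≤ v 0 := by
      by_contra hneg
      push Not at hneg
      have : δ * (v 0 : ℝ) < 0 := mul_neg_of_pos_of_neg hδ (by exact_mod_cast hneg)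
      linarith [hb.1]
    have h2 := reachable_zero_of_axis hδ _ (v 0) hx0 hb.2.1 rfl
    have e : (⟨v, hv⟩ : ↥(meshVertices cuspDomain δ)) = ⟨v, Or.inr hH⟩ := rfl
    rw [e]
    exact h1.trans (by convert h2)

/-- The mesh vertex graph of the cusp domain is preconnected. [folklore] -/
theorem meshVertexGraph_cuspDomain_preconnected {δ : ℝ} (hδ : 0 < δ) :
    (meshVertexGraph cuspDomain δ).Preconnected := fun u v =>
  (meshVertexGraph_cuspDomain_reachable_zero hδ u.1 u.2).trans
    (meshVertexGraph_cuspDomain_reachable_zero hδ v.1 v.2).symm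

/-- For the cusp domain, `Ω_δ` is all of `Ω ∩ δℤ²`. [folklore] -/
theorem meshDomain_cuspDomain {δ : ℝ} (hδ : 0 < δ) :
    meshDomain cuspDomain δ = meshVertices cuspDomain δ := by
  refine Set.Subset.antisymm (meshDomain_subset_meshVertices _ _) fun v hv => ?_
  have hsub := (meshVertexGraph_cuspDomain_preconnected hδ).subsingleton_connectedComponent
  simp only [meshDomain, Set.mem_iUnion, Set.mem_image]
  refine ⟨(meshVertexGraph cuspDomain δ).connectedComponentMk ⟨v, hv⟩, fun C' => ?_, ⟨v, hv⟩,
    ?_, rfl⟩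
  · rw [Subsingleton.elim C' ((meshVertexGraph cuspDomain δ).connectedComponentMk ⟨v, hv⟩)]
  · rw [SimpleGraph.ConnectedComponent.mem_supp_iff]

/-- For the cusp domain, any two sites of `Ω_δ` are joined in the graph `Ω_δ`. [folklore] -/
theorem reachable_discreteDomainGraph_cuspDomain {δ : ℝ} (hδ : 0 < δ) {u v : Site 2}
    (hu : u ∈ meshDomain cuspDomain δ) (hv : v ∈ meshDomain cuspDomain δ) :
    (discreteDomainGraph cuspDomain δ).Reachable u v := by
  rw [meshDomain_cuspDomain hδ] at hu hv
  let φ : meshVertexGraph cuspDomain δ →g discreteDomainGraph cuspDomain δ :=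
    { toFun := fun w => w.1
      map_rel' := fun {a b} hab => discreteDomainGraph_adj_iff.2 ⟨SimpleGraph.induce_adj.1 hab,
        (meshDomain_cuspDomain hδ).symm ▸ a.2, (meshDomain_cuspDomain hδ).symm ▸ b.2⟩ }
  exact ((meshVertexGraph_cuspDomain_preconnected hδ) ⟨u, hu⟩ ⟨v, hv⟩).map φ


/-! ### The dead-end filament of the cusp domain -/

/-- The index of the first filament site: `k₀ = ⌈2/δ - √(10/δ)⌉`. [folklore] -/
def cuspK0 (δ : ℝ) : ℕ := ⌈2 / δ - Real.sqrt (10 / δ)⌉₊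

/-- The number of filament sites: `N = ⌈2/δ⌉ - k₀`. [folklore] -/
def cuspN (δ : ℝ) : ℕ := ⌈2 / δ⌉₊ - cuspK0 δ

/-- The filament sites `f j = (k₀ - 1 + j, 0)`, `1 ≤ j ≤ N` (and the attachment site `f 0`).
[folklore] -/
def cuspFil (δ : ℝ) (j : ℕ) : Site 2 := ![(cuspK0 δ : ℤ) - 1 + j, 0]

/-- First coordinate of a filament site. [folklore] -/
@[simp] theorem cuspFil_zero_apply (δ : ℝ) (j : ℕ) : cuspFil δ j 0 = (cuspK0 δ : ℤ) - 1 + j := rfl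

/-- Second coordinate of a filament site. [folklore] -/
@[simp] theorem cuspFil_one_apply (δ : ℝ) (j : ℕ) : cuspFil δ j 1 = 0 := rfl

/-- `δ k₀ ≥ 2 - √(10δ)`. [folklore] -/
theorem two_sub_sqrt_le_mul_cuspK0 {δ : ℝ} (hδ : 0 < δ) :
    2 - Real.sqrt (10 * δ) ≤ δ * cuspK0 δ := by
  have h1 : 2 / δ - Real.sqrt (10 / δ) ≤ (cuspK0 δ : ℝ) := Nat.le_ceil _
  have h2 : δ * (2 / δ - Real.sqrt (10 / δ)) = 2 - Real.sqrt (10 * δ) := by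
    have hs : Real.sqrt (10 / δ) = Real.sqrt (10 * δ) / δ := by
      rw [eq_div_iff hδ.ne']
      have h3 : Real.sqrt (10 / δ) * δ = Real.sqrt (10 / δ) * Real.sqrt (δ ^ 2) := by
        rw [Real.sqrt_sq hδ.le]
      rw [h3, ← Real.sqrt_mul (by positivity)]
      congr 1
      field_simp
    rw [hs]
    field_simp
  calc 2 - Real.sqrt (10 * δ) = δ * (2 / δ - Real.sqrt (10 / δ)) := h2.symm
    _ ≤ δ * cuspK0 δ := mul_le_mul_of_nonneg_left h1 hδ.le

/-- `k₀ < 2/δ - √(10/δ) + 1` (for `δ ≤ 2/5`, when `2/δ - √(10/δ) ≥ 0`). [folklore] -/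
theorem cuspK0_lt {δ : ℝ} (hδ : 0 < δ) (hδ' : δ ≤ 2 / 5) :
    (cuspK0 δ : ℝ) < 2 / δ - Real.sqrt (10 / δ) + 1 := by
  apply Nat.ceil_lt_add_one
  rw [sub_nonneg, Real.sqrt_le_left (by positivity)]
  rw [div_pow, div_le_div_iff₀ hδ (by positivity)]
  have : δ ^ 2 ≤ 2 / 5 * δ := by nlinarith
  nlinarith

/-- `N ≥ √(10/δ) - 1` (for `δ ≤ 2/5`). [folklore] -/
theorem sqrt_sub_one_lt_cuspN {δ : ℝ} (hδ : 0 < δ) (hδ' : δ ≤ 2 / 5) :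
    Real.sqrt (10 / δ) - 1 < (cuspN δ : ℝ) := by
  have h1 := cuspK0_lt hδ hδ'
  have h2 : 2 / δ ≤ (⌈2 / δ⌉₊ : ℝ) := Nat.le_ceil _
  have h3 : (cuspK0 δ : ℝ) ≤ (⌈2 / δ⌉₊ : ℝ) := by
    have : Real.sqrt (10 / δ) ≥ 1 := by
      rw [ge_iff_le, Real.le_sqrt (by norm_num) (by positivity), le_div_iff₀ hδ]; linarith
    linarith
  have h4 : ((cuspN δ : ℕ) : ℝ) = (⌈2 / δ⌉₊ : ℝ) - cuspK0 δ := by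
    rw [cuspN, Nat.cast_sub (by exact_mod_cast h3)]
  rw [h4]; linarith

/-- `k₀ + N = ⌈2/δ⌉` (for `δ ≤ 2/5`). [folklore] -/
theorem cuspK0_add_cuspN {δ : ℝ} (hδ : 0 < δ) (hδ' : δ ≤ 2 / 5) : cuspK0 δ + cuspN δ = ⌈2 / δ⌉₊ := by
  have h1 := cuspK0_lt hδ hδ'
  have h2 : 2 / δ ≤ (⌈2 / δ⌉₊ : ℝ) := Nat.le_ceil _
  have h3 : (cuspK0 δ : ℝ) ≤ (⌈2 / δ⌉₊ : ℝ) := by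
    have : Real.sqrt (10 / δ) ≥ 1 := by
      rw [ge_iff_le, Real.le_sqrt (by norm_num) (by positivity), le_div_iff₀ hδ]; linarith
    linarith
  rw [cuspN]
  have : cuspK0 δ ≤ ⌈2 / δ⌉₊ := by exact_mod_cast h3
  omega

/-- Beyond `k₀` the cusp is thinner than one mesh: `(2 - δk)²/10 ≤ δ` for `k₀ ≤ k`, `δk ≤ 2`.
[folklore] -/
theorem cusp_height_le {δ : ℝ} (hδ : 0 < δ) {k : ℤ} (hk : (cuspK0 δ : ℤ) ≤ k) (hk2 : δ * k ≤ 2) :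
    (2 - δ * k) ^ 2 / 10 ≤ δ := by
  have h1 := two_sub_sqrt_le_mul_cuspK0 hδ
  have h2 : δ * (cuspK0 δ : ℝ) ≤ δ * k := mul_le_mul_of_nonneg_left (by exact_mod_cast hk) hδ.le
  have h3 : 0 ≤ 2 - δ * k := by linarith
  have h4 : 2 - δ * k ≤ Real.sqrt (10 * δ) := by linarith
  have h5 : (2 - δ * k) ^ 2 ≤ 10 * δ := by
    calc (2 - δ * k) ^ 2 ≤ Real.sqrt (10 * δ) ^ 2 := pow_le_pow_left₀ h3 h4 2
      _ = 10 * δ := Real.sq_sqrt (by positivity)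
  linarith

/-- **Beyond `k₀`, `Ω_δ` is the filament.** A mesh vertex of the cusp domain with first
coordinate `≥ k₀` lies on the real axis and has `δ ·` first coordinate `< 2` (`δ < 1/10`).
[folklore] -/
theorem eq_axis_of_mem_meshVertices_cuspDomain {δ : ℝ} (hδ : 0 < δ) (hδ' : δ < 1 / 10)
    {v : Site 2} (hv : v ∈ meshVertices cuspDomain δ) (hk : (cuspK0 δ : ℤ) ≤ v 0) :
    v 1 = 0 ∧ δ * v 0 < 2 := by
  have h1 := two_sub_sqrt_le_mul_cuspK0 hδ
  have hs : Real.sqrt (10 * δ) < 1 := by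
    rw [Real.sqrt_lt' one_pos]; linarith
  have hv0 : 1 < δ * v 0 := by
    have : δ * (cuspK0 δ : ℝ) ≤ δ * v 0 := mul_le_mul_of_nonneg_left (by exact_mod_cast hk) hδ.le
    linarith
  rcases mem_meshVertices_cuspDomain_iff.1 hv with hD | hH
  · exfalso
    rw [mem_meshVertices_unitDisk] at hD
    have := (Complex.abs_re_le_norm (meshPoint δ v)).trans_lt hD
    rw [meshPoint_re] at this
    have := (le_abs_self (δ * v 0)).trans_lt this
    linarith
  · obtain ⟨-, h2, h3⟩ := meshPoint_mem_cuspHorn_iff.1 hH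
    refine ⟨?_, h2⟩
    have h4 := cusp_height_le hδ hk h2.le
    have h5 : |δ * (v 1 : ℝ)| < δ := h3.trans_le h4
    rw [abs_mul, abs_of_pos hδ] at h5
    have h6 : |((v 1 : ℤ) : ℝ)| < 1 := by nlinarith
    have h7 : |v 1| < 1 := by exact_mod_cast h6
    have h8 := abs_lt.1 h7
    omega

/-- The filament sites `f j`, `1 ≤ j ≤ N`, are sites of `Ω_δ` (`δ ≤ 2/5`). [folklore] -/
theorem cuspFil_mem_meshDomain {δ : ℝ} (hδ : 0 < δ) (hδ' : δ ≤ 2 / 5) {j : ℕ} (hj1 : 1 ≤ j)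
    (hjN : j ≤ cuspN δ) : cuspFil δ j ∈ meshDomain cuspDomain δ := by
  rw [meshDomain_cuspDomain hδ]
  have hKN := cuspK0_add_cuspN hδ hδ'
  have h0 : (0 : ℝ) ≤ δ * (((cuspK0 δ : ℤ) - 1 + j : ℤ) : ℝ) := by
    apply mul_nonneg hδ.le; push_cast
    have : (1 : ℝ) ≤ j := by exact_mod_cast hj1
    have : (0 : ℝ) ≤ cuspK0 δ := Nat.cast_nonneg _
    linarith
  have h2 : δ * (((cuspK0 δ : ℤ) - 1 + j : ℤ) : ℝ) < 2 := by
    have hlt : (⌈2 / δ⌉₊ : ℝ) < 2 / δ + 1 := Nat.ceil_lt_add_one (by positivity)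
    have hle : ((cuspK0 δ : ℤ) - 1 + j : ℤ) ≤ (⌈2 / δ⌉₊ : ℤ) - 1 := by omega
    have hle' : (((cuspK0 δ : ℤ) - 1 + j : ℤ) : ℝ) ≤ (⌈2 / δ⌉₊ : ℝ) - 1 := by exact_mod_cast hle
    calc δ * (((cuspK0 δ : ℤ) - 1 + j : ℤ) : ℝ) ≤ δ * ((⌈2 / δ⌉₊ : ℝ) - 1) :=
          mul_le_mul_of_nonneg_left hle' hδ.le
      _ < δ * (2 / δ) := by apply mul_lt_mul_of_pos_left _ hδ; linarith
      _ = 2 := by field_simp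
  exact axis_mem_meshVertices_cuspDomain h0 h2

/-- Consecutive filament sites are adjacent in `Ω_δ` (`1 ≤ j < N`, `δ ≤ 2/5`). [folklore] -/
theorem cuspFil_adj {δ : ℝ} (hδ : 0 < δ) (hδ' : δ ≤ 2 / 5) {j : ℕ} (hj1 : 1 ≤ j)
    (hjN : j < cuspN δ) :
    (discreteDomainGraph cuspDomain δ).Adj (cuspFil δ j) (cuspFil δ (j + 1)) := by
  have hm1 := cuspFil_mem_meshDomain hδ hδ' hj1 hjN.le
  have hm2 := cuspFil_mem_meshDomain hδ hδ' (by omega : 1 ≤ j + 1) (by omega : j + 1 ≤ cuspN δ)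
  refine discreteDomainGraph_adj_iff.2 ⟨?_, hm1, hm2⟩
  have hm2' := hm2
  rw [meshDomain_cuspDomain hδ, mem_meshVertices_iff] at hm2'
  have e : cuspFil δ j = ![((cuspK0 δ : ℤ) - 1 + (j + 1 : ℕ)) - 1, 0] := by
    funext i; fin_cases i
    · simp; ring
    · simp
  rw [e, cuspFil]
  apply meshGraph_cuspDomain_adj_axis hδ
  · apply mul_nonneg hδ.le
    push_cast
    have : (1 : ℝ) ≤ j := by exact_mod_cast hj1
    have : (0 : ℝ) ≤ cuspK0 δ := Nat.cast_nonneg _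
    linarith
  · have hlt : (⌈2 / δ⌉₊ : ℝ) < 2 / δ + 1 := Nat.ceil_lt_add_one (by positivity)
    have hKN := cuspK0_add_cuspN hδ hδ'
    have hle : ((cuspK0 δ : ℤ) - 1 + (j + 1 : ℕ) : ℤ) ≤ (⌈2 / δ⌉₊ : ℤ) - 1 := by push_cast; omega
    have hle' : (((cuspK0 δ : ℤ) - 1 + (j + 1 : ℕ) : ℤ) : ℝ) ≤ (⌈2 / δ⌉₊ : ℝ) - 1 := by
      exact_mod_cast hle
    calc δ * (((cuspK0 δ : ℤ) - 1 + (j + 1 : ℕ) : ℤ) : ℝ) ≤ δ * ((⌈2 / δ⌉₊ : ℝ) - 1) :=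
          mul_le_mul_of_nonneg_left hle' hδ.le
      _ < δ * (2 / δ) := by apply mul_lt_mul_of_pos_left _ hδ; linarith
      _ = 2 := by field_simp

/-- The filament is injective. [folklore] -/
theorem cuspFil_injective (δ : ℝ) : Function.Injective (cuspFil δ) := by
  intro i j h
  have := congrFun h 0
  simp only [cuspFil_zero_apply, add_right_inj, Nat.cast_inj] at this
  exact this

/-- **The filament is dangling**: every `Ω_δ`-neighbour of `f j` (`1 ≤ j`) is `f (j-1)`, or
`f (j+1)` with `j < N` (`δ < 1/10`). [folklore] -/
theorem cuspFil_neighbours {δ : ℝ} (hδ : 0 < δ) (hδ' : δ < 1 / 10) {j : ℕ} (hj1 : 1 ≤ j)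
    {w : Site 2} (hw : (discreteDomainGraph cuspDomain δ).Adj (cuspFil δ j) w) :
    w = cuspFil δ (j - 1) ∨ (w = cuspFil δ (j + 1) ∧ j < cuspN δ) := by
  obtain ⟨hadj, -, hwD⟩ := discreteDomainGraph_adj_iff.1 hw
  have hzd : (zdGraph 2).Adj (cuspFil δ j) w := meshGraph_le_zdGraph _ _ hadj
  rw [meshDomain_cuspDomain hδ] at hwD
  have h10 : (1 : Fin 2) ≠ 0 := by decide
  obtain ⟨i, hi | hi⟩ := (zdGraph_adj_iff _ _).1 hzd
  · -- `w = f j + e_i`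
    fin_cases i
    · -- right neighbour: `f (j + 1)`, which must still be a mesh vertex
      right
      have hw' : w = cuspFil δ (j + 1) := by
        rw [hi]; funext k; fin_cases k
        · simp [cuspFil]; ring
        · simp [cuspFil]
      refine ⟨hw', ?_⟩
      have hk : (cuspK0 δ : ℤ) ≤ w 0 := by rw [hw']; simp
      have h2 := (eq_axis_of_mem_meshVertices_cuspDomain hδ hδ' hwD hk).2
      rw [hw'] at h2
      simp only [cuspFil_zero_apply] at h2
      -- `δ (k₀ + j) < 2` gives `k₀ + j < ⌈2/δ⌉ = k₀ + N`
      have hKN := cuspK0_add_cuspN hδ (by linarith)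
      have hlt : ((cuspK0 δ : ℤ) - 1 + (j + 1 : ℕ) : ℝ) < 2 / δ := by
        rw [lt_div_iff₀ hδ]; push_cast at h2 ⊢; linarith
      have hle : (2 / δ : ℝ) ≤ (⌈2 / δ⌉₊ : ℝ) := Nat.le_ceil _
      have : ((cuspK0 δ : ℤ) - 1 + (j + 1 : ℕ) : ℝ) < ((cuspK0 δ + cuspN δ : ℕ) : ℝ) := by
        rw [hKN]; linarith
      push_cast at this
      have : (j : ℝ) < cuspN δ := by linarith
      exact_mod_cast this
    · -- vertical neighbour: impossible beyond `k₀`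
      exfalso
      have hk : (cuspK0 δ : ℤ) ≤ w 0 := by rw [hi]; simp; omega
      have h1 := (eq_axis_of_mem_meshVertices_cuspDomain hδ hδ' hwD hk).1
      rw [hi] at h1
      simp at h1
  · -- `f j = w + e_i`, i.e. `w = f j - e_i`
    fin_cases i
    · left
      funext k; fin_cases k
      · have := congrFun hi 0
        simp at this ⊢
        have h1 : ((j - 1 : ℕ) : ℤ) = (j : ℤ) - 1 := by omega
        rw [h1]; linarith
      · have := congrFun hi 1
        simp [h10] at this ⊢
        exact this.symm
    · exfalso
      have h0 := congrFun hi 0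
      have h1 := congrFun hi 1
      simp at h0 h1
      have hk : (cuspK0 δ : ℤ) ≤ w 0 := by rw [← h0]; omega
      have := (eq_axis_of_mem_meshVertices_cuspDomain hδ hδ' hwD hk).1
      omega

/-! ### Closest sites to points of the unit circle lie off the filament -/

/-- A site of `Ω_δ` (cusp domain) closest to a point `z` of the unit circle is within `3δ` of `z`
(`0 < δ ≤ 1/4`). [folklore] -/
theorem IsClosestSite.dist_le_cuspDomain {δ : ℝ} (hδ : 0 < δ) (hδ' : δ ≤ 1 / 4) {z : ℂ}
    (hz : ‖z‖ = 1) {w : Site 2} (hw : IsClosestSite cuspDomain δ z w) :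
    dist (meshPoint δ w) z ≤ 3 * δ := by
  set y : ℂ := ((1 - 2 * δ : ℝ) : ℂ) * z with hy
  have hy_norm : ‖y‖ = 1 - 2 * δ := by
    rw [hy, norm_mul, Complex.norm_real, hz, mul_one, Real.norm_eq_abs, abs_of_nonneg (by linarith)]
  have hyz : dist y z = 2 * δ := by
    rw [dist_eq_norm, hy]
    have : ((1 - 2 * δ : ℝ) : ℂ) * z - z = ((-(2 * δ) : ℝ) : ℂ) * z := by push_cast; ring
    rw [this, norm_mul, Complex.norm_real, hz, mul_one, Real.norm_eq_abs, abs_neg,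
      abs_of_nonneg (by linarith)]
  have hnear := dist_meshPoint_nearestSite_le hδ y
  have hmem : nearestSite δ y ∈ meshDomain cuspDomain δ := by
    rw [meshDomain_cuspDomain hδ]
    refine meshVertices_mono unitDisk_subset_cuspDomain δ ?_
    rw [mem_meshVertices_unitDisk]
    calc ‖meshPoint δ (nearestSite δ y)‖ ≤ ‖y‖ + dist (meshPoint δ (nearestSite δ y)) y := by
          rw [dist_eq_norm]
          exact norm_le_insert' _ _ |>.trans_eq (by ring)
      _ ≤ 1 - 2 * δ + δ := by rw [hy_norm]; linarith
      _ < 1 := by linarith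
  calc dist (meshPoint δ w) z ≤ dist (meshPoint δ (nearestSite δ y)) z := hw.2 _ hmem
    _ ≤ dist (meshPoint δ (nearestSite δ y)) y + dist y z := dist_triangle _ _ _
    _ ≤ δ + 2 * δ := add_le_add hnear hyz.le
    _ = 3 * δ := by ring

/-- A closest site to a point of the unit circle has first coordinate `< k₀`, so it is not a
filament site (`δ ≤ 1/20`). [folklore] -/
theorem IsClosestSite.apply_zero_lt_cuspK0 {δ : ℝ} (hδ : 0 < δ) (hδ' : δ ≤ 1 / 20) {z : ℂ}
    (hz : ‖z‖ = 1) {w : Site 2} (hw : IsClosestSite cuspDomain δ z w) :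
    w 0 < (cuspK0 δ : ℤ) := by
  have h1 := hw.dist_le_cuspDomain hδ (by linarith) hz
  have h2 := two_sub_sqrt_le_mul_cuspK0 hδ
  have hs : Real.sqrt (10 * δ) < 3 / 4 := by
    rw [Real.sqrt_lt' (by norm_num)]; linarith
  -- `δ w₀ ≤ Re z + 3δ ≤ 1 + 3δ < 2 - √(10δ) ≤ δ k₀`
  have h3 : δ * w 0 ≤ 1 + 3 * δ := by
    have hre : |(meshPoint δ w - z).re| ≤ ‖meshPoint δ w - z‖ := Complex.abs_re_le_norm _
    rw [← dist_eq_norm] at hre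
    have hzre : |z.re| ≤ 1 := hz ▸ Complex.abs_re_le_norm z
    have := abs_le.1 (hre.trans h1)
    have := abs_le.1 hzre
    simp only [Complex.sub_re, meshPoint_re] at *
    linarith
  have h4 : δ * (w 0 : ℝ) < δ * cuspK0 δ := by linarith
  have h5 : (w 0 : ℝ) < cuspK0 δ := lt_of_mul_lt_mul_left h4 hδ.le
  exact_mod_cast h5

/-- Closest sites to points of the unit circle are not filament sites (`δ ≤ 1/20`). [folklore] -/
theorem cuspFil_ne_of_isClosestSite {δ : ℝ} (hδ : 0 < δ) (hδ' : δ ≤ 1 / 20) {z : ℂ}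
    (hz : ‖z‖ = 1) {w : Site 2} (hw : IsClosestSite cuspDomain δ z w) {j : ℕ} (hj : 1 ≤ j) :
    cuspFil δ j ≠ w := by
  intro h
  have h1 := hw.apply_zero_lt_cuspK0 hδ hδ' hz
  rw [← h, cuspFil_zero_apply] at h1
  omega


/-! ### The family of `m`-boxes of `Ω_δ` (cusp domain) is connected -/

/-- **Domination**: a site `p'` obtained from a site `p` of `Ω_δ` (cusp domain) by moving
vertically towards the real axis (`p'₀ = p₀`, `|p'₁| ≤ |p₁|`), or horizontally towards the
imaginary axis without crossing it from the left (`p'₁ = p₁`, `|p'₀| ≤ |p₀|`, and `p₀ < 0` or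
`0 ≤ p'₀`), is again a site of `Ω_δ` (`δ ≤ 1/2`). [folklore] -/
theorem mem_meshVertices_cuspDomain_of_dominated {δ : ℝ} (hδ : 0 < δ) (hδ2 : δ ≤ 1 / 2)
    {p p' : Site 2} (hp : p ∈ meshVertices cuspDomain δ)
    (h : (p' 0 = p 0 ∧ |p' 1| ≤ |p 1|) ∨ (p' 1 = p 1 ∧ |p' 0| ≤ |p 0| ∧ (p 0 < 0 ∨ 0 ≤ p' 0))) :
    p' ∈ meshVertices cuspDomain δ := by
  -- coordinatewise absolute values do not increase, so the disk case is immediate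
  have habs : ∀ i, |(p' i : ℝ)| ≤ |(p i : ℝ)| := by
    rw [Fin.forall_fin_two]
    rcases h with ⟨h0, h1⟩ | ⟨h1, h0, -⟩
    · exact ⟨by rw [h0], by exact_mod_cast h1⟩
    · exact ⟨by exact_mod_cast h0, by rw [h1]⟩
  have hsq : ∑ j, ((p' j : ℤ) : ℝ) ^ 2 ≤ ∑ j, ((p j : ℤ) : ℝ) ^ 2 :=
    Finset.sum_le_sum fun j _ => sq_le_sq.2 (habs j)
  rcases mem_meshVertices_cuspDomain_iff.1 hp with hD | hH
  · exact Or.inl (mem_meshVertices_unitDisk_of_sq_le hD hsq)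
  · obtain ⟨h1, h2, h3⟩ := meshPoint_mem_cuspHorn_iff.1 hH
    rcases h with ⟨h0, h01⟩ | ⟨h01, h0, hcase⟩
    · -- vertical move inside the horn
      refine Or.inr (meshPoint_mem_cuspHorn_iff.2 ?_)
      rw [h0]
      refine ⟨h1, h2, lt_of_le_of_lt ?_ h3⟩
      rw [abs_mul, abs_mul, abs_of_pos hδ]
      exact mul_le_mul_of_nonneg_left (by exact_mod_cast h01) hδ.le
    · -- horizontal move: `p₀ > 0` (the horn lies in `Re > 1/2`), so `0 ≤ p'₀ ≤ p₀`
      have hp0 : (0 : ℝ) < p 0 := by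
        by_contra hle; push Not at hle
        have : δ * (p 0 : ℝ) ≤ 0 := mul_nonpos_of_nonneg_of_nonpos hδ.le hle
        linarith
      have hp'0 : 0 ≤ p' 0 := by
        rcases hcase with hc | hc
        · exfalso; have : ((p 0 : ℤ) : ℝ) < 0 := by exact_mod_cast hc
          linarith
        · exact hc
      have hle : (p' 0 : ℝ) ≤ p 0 := by
        have := habs 0
        rwa [abs_of_nonneg (by exact_mod_cast hp'0 : (0 : ℝ) ≤ p' 0), abs_of_pos hp0] at this
      by_cases hhalf : 1 / 2 < δ * p' 0
      · -- still in the horn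
        refine Or.inr (meshPoint_mem_cuspHorn_iff.2 ⟨hhalf, ?_, ?_⟩)
        · nlinarith
        · rw [h01]
          refine h3.trans_le (div_le_div_of_nonneg_right ?_ (by norm_num))
          have : δ * (p' 0 : ℝ) ≤ δ * p 0 := mul_le_mul_of_nonneg_left hle hδ.le
          nlinarith
      · -- left of `Re = 1/2`: in the disk, since `|Im| < (3/2)²/10`
        push Not at hhalf
        refine mem_meshVertices_cuspDomain_iff.2 (Or.inl ?_)
        rw [mem_meshVertices_unitDisk_iff_sq, Fin.sum_univ_two]
        have him : |δ * (p 1 : ℝ)| < 9 / 40 := by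
          refine h3.trans_le ?_
          have : (2 - δ * p 0) ^ 2 ≤ (3 / 2) ^ 2 := by
            apply pow_le_pow_left₀ (by linarith)
            linarith
          linarith
        rw [h01]
        have h0' : 0 ≤ δ * (p' 0 : ℝ) := mul_nonneg hδ.le (by exact_mod_cast hp'0)
        have hsq0 : (δ * (p' 0 : ℝ)) ^ 2 ≤ 1 / 4 := by nlinarith
        have hsq1 : (δ * (p 1 : ℝ)) ^ 2 < 81 / 1600 := by
          have := abs_lt.1 him; nlinarith
        nlinarith

/-- The family of `m`-boxes of `Ω_δ`: corners `z` with `B(z) ⊆ Ω_δ`. [cite: DuminilCopinKozmaYadin2014, §3 (𝓕(Ω_δ, m))] -/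
def boxFamily (Ω : Set ℂ) (δ : ℝ) (m : ℕ) : Set (Site 2) :=
  {z | ∀ p ∈ mBox m z, p ∈ meshDomain Ω δ}

/-- Membership in the box family. [cite: DuminilCopinKozmaYadin2014, §3 (𝓕(Ω_δ, m))] -/
theorem mem_boxFamily_iff {Ω : Set ℂ} {δ : ℝ} {m : ℕ} {z : Site 2} :
    z ∈ boxFamily Ω δ m ↔ ∀ p ∈ mBox m z, p ∈ meshDomain Ω δ := Iff.rfl

/-- A move of the box corner `z ↦ z'` stays in the box family as soon as every site of `B(z')`
is dominated (in the sense of `mem_meshVertices_cuspDomain_of_dominated`) by a site of `B(z)`.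
[folklore] -/
theorem mem_boxFamily_cuspDomain_of_forall_dominated {δ : ℝ} (hδ : 0 < δ) (hδ2 : δ ≤ 1 / 2)
    {m : ℕ} {z z' : Site 2} (hz : z ∈ boxFamily cuspDomain δ m)
    (h : ∀ p' ∈ mBox m z', ∃ p ∈ mBox m z,
      (p' 0 = p 0 ∧ |p' 1| ≤ |p 1|) ∨ (p' 1 = p 1 ∧ |p' 0| ≤ |p 0| ∧ (p 0 < 0 ∨ 0 ≤ p' 0))) :
    z' ∈ boxFamily cuspDomain δ m := by
  intro p' hp'
  obtain ⟨p, hp, hdom⟩ := h p' hp'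
  rw [meshDomain_cuspDomain hδ]
  exact mem_meshVertices_cuspDomain_of_dominated hδ hδ2 ((meshDomain_cuspDomain hδ) ▸ hz p hp) hdom

/-- Vertical move towards the real axis from above: `z₁ ≥ 1`. [folklore] -/
theorem boxFamily_cuspDomain_sub_one {δ : ℝ} (hδ : 0 < δ) (hδ2 : δ ≤ 1 / 2) {m : ℕ}
    {z : Site 2} (hz : z ∈ boxFamily cuspDomain δ m) (h1 : 1 ≤ z 1) :
    z - Pi.single 1 1 ∈ boxFamily cuspDomain δ m := by
  refine mem_boxFamily_cuspDomain_of_forall_dominated hδ hδ2 hz fun p' hp' => ?_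
  refine ⟨p' + Pi.single 1 (2 * (m : ℤ) + 2), ?_, Or.inl ⟨by simp, ?_⟩⟩
  · rw [mem_mBox_iff] at hp' ⊢
    intro i
    have := hp' i
    fin_cases i
    · simpa using this
    · simp only [Fin.mk_one, Pi.add_apply, Pi.single_eq_same, Pi.sub_apply] at this ⊢
      constructor <;> linarith [this.1, this.2]
  · have := (mem_mBox_iff.1 hp') 1
    simp only [Pi.sub_apply, Pi.single_eq_same] at this
    simp only [Pi.add_apply, Pi.single_eq_same]
    have hlo : 0 ≤ p' 1 := by nlinarith [this.1]
    rw [abs_of_nonneg hlo, abs_of_nonneg (by positivity)]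
    linarith

/-- Vertical move towards the real axis from below: `z₁ ≤ -2`. [folklore] -/
theorem boxFamily_cuspDomain_add_one {δ : ℝ} (hδ : 0 < δ) (hδ2 : δ ≤ 1 / 2) {m : ℕ}
    {z : Site 2} (hz : z ∈ boxFamily cuspDomain δ m) (h1 : z 1 ≤ -2) :
    z + Pi.single 1 1 ∈ boxFamily cuspDomain δ m := by
  refine mem_boxFamily_cuspDomain_of_forall_dominated hδ hδ2 hz fun p' hp' => ?_
  refine ⟨p' - Pi.single 1 (2 * (m : ℤ) + 2), ?_, Or.inl ⟨by simp, ?_⟩⟩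
  · rw [mem_mBox_iff] at hp' ⊢
    intro i
    have := hp' i
    fin_cases i
    · simpa using this
    · simp only [Fin.mk_one, Pi.add_apply, Pi.single_eq_same, Pi.sub_apply] at this ⊢
      constructor <;> linarith [this.1, this.2]
  · have := (mem_mBox_iff.1 hp') 1
    simp only [Pi.add_apply, Pi.single_eq_same] at this
    simp only [Pi.sub_apply, Pi.single_eq_same]
    have hhi : p' 1 ≤ -1 := by nlinarith [this.2]
    rw [abs_of_nonpos (by linarith), abs_of_nonpos (by nlinarith)]
    nlinarith

/-- Horizontal move towards the imaginary axis from the right: `z₀ ≥ 1`. [folklore] -/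
theorem boxFamily_cuspDomain_sub_zero {δ : ℝ} (hδ : 0 < δ) (hδ2 : δ ≤ 1 / 2) {m : ℕ}
    {z : Site 2} (hz : z ∈ boxFamily cuspDomain δ m) (h0 : 1 ≤ z 0) :
    z - Pi.single 0 1 ∈ boxFamily cuspDomain δ m := by
  refine mem_boxFamily_cuspDomain_of_forall_dominated hδ hδ2 hz fun p' hp' => ?_
  refine ⟨p' + Pi.single 0 (2 * (m : ℤ) + 2), ?_, Or.inr ⟨by simp, ?_, ?_⟩⟩
  · rw [mem_mBox_iff] at hp' ⊢
    intro i
    have := hp' i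
    fin_cases i
    · simp only [Fin.zero_eta, Pi.add_apply, Pi.single_eq_same, Pi.sub_apply] at this ⊢
      constructor <;> linarith [this.1, this.2]
    · simpa using this
  · have := (mem_mBox_iff.1 hp') 0
    simp only [Pi.sub_apply, Pi.single_eq_same] at this
    simp only [Pi.add_apply, Pi.single_eq_same]
    have hlo : 0 ≤ p' 0 := by nlinarith [this.1]
    rw [abs_of_nonneg hlo, abs_of_nonneg (by positivity)]
    linarith
  · right
    have := (mem_mBox_iff.1 hp') 0
    simp only [Pi.sub_apply, Pi.single_eq_same] at this
    nlinarith [this.1]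

/-- Horizontal move towards the imaginary axis from the left: `z₀ ≤ -1` (all sites have
negative abscissa, so they are disk sites; for `z₀ = -1` the dominating site is the mirror image
`x ↦ -1 - x`). [folklore] -/
theorem boxFamily_cuspDomain_add_zero {δ : ℝ} (hδ : 0 < δ) (hδ2 : δ ≤ 1 / 2) {m : ℕ}
    {z : Site 2} (hz : z ∈ boxFamily cuspDomain δ m) (h0 : z 0 ≤ -1) :
    z + Pi.single 0 1 ∈ boxFamily cuspDomain δ m := by
  refine mem_boxFamily_cuspDomain_of_forall_dominated hδ hδ2 hz fun p' hp' => ?_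
  have h10 : (1 : Fin 2) ≠ 0 := by decide
  rcases lt_or_eq_of_le h0 with hlt | heq
  · -- `z₀ ≤ -2`: shift back by a full period
    refine ⟨p' - Pi.single 0 (2 * (m : ℤ) + 2), ?_, Or.inr ⟨by simp [h10], ?_, Or.inl ?_⟩⟩
    · rw [mem_mBox_iff] at hp' ⊢
      intro i
      have := hp' i
      fin_cases i
      · simp only [Fin.zero_eta, Pi.add_apply, Pi.single_eq_same, Pi.sub_apply] at this ⊢
        constructor <;> linarith [this.1, this.2]
      · simpa using this
    · have := (mem_mBox_iff.1 hp') 0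
      simp only [Pi.add_apply, Pi.single_eq_same] at this
      simp only [Pi.sub_apply, Pi.single_eq_same]
      have hz2 : z 0 ≤ -2 := by omega
      have hhi : p' 0 ≤ -1 := by nlinarith [this.2]
      rw [abs_of_nonpos (by linarith), abs_of_nonpos (by nlinarith)]
      nlinarith
    · have := (mem_mBox_iff.1 hp') 0
      simp only [Pi.add_apply, Pi.single_eq_same] at this
      simp only [Pi.sub_apply, Pi.single_eq_same]
      have hz2 : z 0 ≤ -2 := by omega
      nlinarith [this.2]
  · -- `z₀ = -1`: the new box is `B(0, z₁)`; mirror `x ↦ -1 - x`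
    refine ⟨![-1 - p' 0, p' 1], ?_, Or.inr ⟨by simp, ?_, Or.inl ?_⟩⟩
    · rw [mem_mBox_iff] at hp' ⊢
      intro i
      have := hp' i
      fin_cases i
      · simp only [Fin.zero_eta, Pi.add_apply, Pi.single_eq_same, heq] at this
        simp only [Fin.zero_eta, Matrix.cons_val_zero, heq]
        constructor <;> linarith [this.1, this.2]
      · simpa [h10] using this
    · have := (mem_mBox_iff.1 hp') 0
      simp only [Pi.add_apply, Pi.single_eq_same, heq] at this
      simp only [Matrix.cons_val_zero]
      have hlo : 0 ≤ p' 0 := by linarith [this.1]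
      rw [abs_of_nonneg hlo, abs_of_nonpos (by linarith)]
      linarith
    · have := (mem_mBox_iff.1 hp') 0
      simp only [Pi.add_apply, Pi.single_eq_same, heq] at this
      simp only [Matrix.cons_val_zero]
      linarith [this.1]

/-- The two base boxes `B(0,0) = [0,2m+1]²` and `B(0,-1) = [0,2m+1] × [-(2m+2),-1]` lie in `𝔻_δ`
(hence in `Ω_δ`) once `4(m+1)δ ≤ 1`. [folklore] -/
theorem base_mem_boxFamily_cuspDomain {δ : ℝ} (hδ : 0 < δ) {m : ℕ}
    (hδm : 4 * ((m : ℝ) + 1) * δ ≤ 1) (z : Site 2) (hz0 : z 0 = 0) (hz1 : z 1 = 0 ∨ z 1 = -1) :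
    z ∈ boxFamily cuspDomain δ m := by
  intro p hp
  rw [meshDomain_cuspDomain hδ]
  refine mem_meshVertices_cuspDomain_iff.2 (Or.inl (mem_meshVertices_unitDisk_iff_sq.2 ?_))
  rw [mem_mBox_iff] at hp
  have h0 := hp 0
  have h1 := hp 1
  rw [hz0, mul_zero, zero_add] at h0
  have hp1 : -(2 * (m : ℤ) + 2) ≤ p 1 ∧ p 1 ≤ 2 * m + 1 := by
    rcases hz1 with hz1 | hz1 <;> rw [hz1] at h1 <;> constructor <;> linarith [h1.1, h1.2]
  have hb : ∀ i, |(p i : ℝ)| ≤ 2 * m + 2 := by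
    rw [Fin.forall_fin_two, abs_le, abs_le]
    refine ⟨⟨?_, ?_⟩, ?_, ?_⟩
    · have : (0 : ℝ) ≤ p 0 := by exact_mod_cast h0.1
      have : (0 : ℝ) ≤ m := Nat.cast_nonneg _
      linarith
    · have : ((p 0 : ℤ) : ℝ) ≤ 2 * m + 1 := by exact_mod_cast h0.2
      linarith
    · exact_mod_cast hp1.1
    · have : ((p 1 : ℤ) : ℝ) ≤ 2 * m + 1 := by exact_mod_cast hp1.2
      linarith
  rw [Fin.sum_univ_two]
  have hsq : ∀ i, ((p i : ℤ) : ℝ) ^ 2 ≤ (2 * m + 2) ^ 2 := fun i =>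
    (sq_abs ((p i : ℤ) : ℝ)) ▸ pow_le_pow_left₀ (abs_nonneg _) (hb i) 2
  have hmδ : δ * (2 * (m : ℝ) + 2) ≤ 1 / 2 := by linarith
  have hmδ2 : (δ * (2 * (m : ℝ) + 2)) ^ 2 ≤ (1 / 2) ^ 2 := pow_le_pow_left₀ (by positivity) hmδ 2
  calc δ ^ 2 * (((p 0 : ℤ) : ℝ) ^ 2 + ((p 1 : ℤ) : ℝ) ^ 2)
      ≤ δ ^ 2 * ((2 * m + 2) ^ 2 + (2 * m + 2) ^ 2) := by
        apply mul_le_mul_of_nonneg_left (add_le_add (hsq 0) (hsq 1)) (by positivity)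
    _ = 2 * (δ * (2 * (m : ℝ) + 2)) ^ 2 := by ring
    _ < 1 := by linarith

/-- **The family of all `m`-boxes of `Ω_δ` is connected** for the cusp domain
(`4(m+1)δ ≤ 1`): every box slides through boxes of `Ω_δ` — towards the real axis, then towards
the imaginary axis — to one of the two base boxes, which are adjacent. This is the hypothesis
"`𝓕(Ω_δ, m)` is connected" of the printed Theorem 6 (box adjacency = adjacency of corners on the
grid `(2m+2)ℤ²`, as in `IsConnectedFamily`). [cite: DuminilCopinKozmaYadin2014, Theorem 6 (𝓕(Ω_δ,m) connected)] -/
theorem boxFamily_cuspDomain_preconnected {δ : ℝ} (hδ : 0 < δ) {m : ℕ}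
    (hδm : 4 * ((m : ℝ) + 1) * δ ≤ 1) :
    ((zdGraph 2).induce (boxFamily cuspDomain δ m)).Preconnected := by
  have hδ2 : δ ≤ 1 / 2 := by
    have : (0 : ℝ) ≤ m := Nat.cast_nonneg _
    nlinarith
  set F := boxFamily cuspDomain δ m with hF
  have h00 : (0 : Site 2) ∈ F := base_mem_boxFamily_cuspDomain hδ hδm 0 rfl (Or.inl rfl)
  -- every box of the family reaches the base box `B(0,0)`
  suffices key : ∀ (n : ℕ) (z : Site 2) (hz : z ∈ F), (z 0).natAbs + (z 1).natAbs = n →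
      ((zdGraph 2).induce F).Reachable ⟨z, hz⟩ ⟨0, h00⟩ from
    fun u v => (key _ u.1 u.2 rfl).trans (key _ v.1 v.2 rfl).symm
  -- one step: an adjacent box of the family with smaller `|z₀| + |z₁|`, unless `z` is a base box
  have step : ∀ (z : Site 2), z ∈ F → (z 0 = 0 ∧ (z 1 = 0 ∨ z 1 = -1)) ∨
      ∃ z' ∈ F, (zdGraph 2).Adj z z' ∧ (z' 0).natAbs + (z' 1).natAbs < (z 0).natAbs + (z 1).natAbs := by
    intro z hz
    have h10 : (1 : Fin 2) ≠ 0 := by decide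
    have h01 : (0 : Fin 2) ≠ 1 := by decide
    by_cases hv1 : 1 ≤ z 1
    · refine Or.inr ⟨z - Pi.single 1 1, boxFamily_cuspDomain_sub_one hδ hδ2 hz hv1,
        (zdGraph_adj_iff _ _).2 ⟨1, Or.inr (by simp)⟩, ?_⟩
      simp only [Pi.sub_apply, Pi.single_eq_same, Pi.single_eq_of_ne h01, sub_zero]
      omega
    by_cases hv2 : z 1 ≤ -2
    · refine Or.inr ⟨z + Pi.single 1 1, boxFamily_cuspDomain_add_one hδ hδ2 hz hv2,
        (zdGraph_adj_iff _ _).2 ⟨1, Or.inl rfl⟩, ?_⟩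
      simp only [Pi.add_apply, Pi.single_eq_same, Pi.single_eq_of_ne h01, add_zero]
      omega
    -- rows `0` and `-1`
    by_cases hh1 : 1 ≤ z 0
    · refine Or.inr ⟨z - Pi.single 0 1, boxFamily_cuspDomain_sub_zero hδ hδ2 hz hh1,
        (zdGraph_adj_iff _ _).2 ⟨0, Or.inr (by simp)⟩, ?_⟩
      simp only [Pi.sub_apply, Pi.single_eq_same, Pi.single_eq_of_ne h10, sub_zero]
      omega
    by_cases hh2 : z 0 ≤ -1
    · refine Or.inr ⟨z + Pi.single 0 1, boxFamily_cuspDomain_add_zero hδ hδ2 hz hh2,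
        (zdGraph_adj_iff _ _).2 ⟨0, Or.inl rfl⟩, ?_⟩
      simp only [Pi.add_apply, Pi.single_eq_same, Pi.single_eq_of_ne h10, add_zero]
      omega
    exact Or.inl ⟨by omega, by omega⟩
  intro n
  induction n using Nat.strong_induction_on with
  | _ n ih =>
    intro z hz hn
    rcases step z hz with ⟨hz0, hz1⟩ | ⟨z', hz', hadj, hlt⟩
    · rcases hz1 with hz1 | hz1
      · have : z = 0 := by funext i; fin_cases i <;> simp [hz0, hz1]
        subst this; rfl
      · -- the second base box `(0,-1)` is adjacent to `(0,0)`
        have hzeq : z = -Pi.single 1 1 := by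
          funext i; fin_cases i <;> simp [hz0, hz1]
        have hadj0 : (zdGraph 2).Adj z 0 :=
          (zdGraph_adj_iff _ _).2 ⟨1, Or.inl (by rw [hzeq]; simp)⟩
        have hadj : ((zdGraph 2).induce F).Adj ⟨z, hz⟩ ⟨0, h00⟩ := SimpleGraph.induce_adj.2 hadj0
        exact hadj.reachable
    · have hadj' : ((zdGraph 2).induce F).Adj ⟨z, hz⟩ ⟨z', hz'⟩ := SimpleGraph.induce_adj.2 hadj
      exact hadj'.reachable.trans (ih _ (hn ▸ hlt) z' hz' rfl)


/-! ### The cusp domain has deterministic holes of `> 1/√δ` sites -/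

/-- **The disk with an outward cusp has a deterministic hole of more than `1/√δ` sites outside
every tube of radius `ξ ≤ M`.** For `M ≥ 1`, `0 < δ ≤ 1/20`, `δ M² ≤ 4`, all points `a, b` of
the unit circle, all closest sites `a_δ, b_δ` of `Ω_δ` (`Ω` the cusp domain) and EVERY
self-avoiding walk `γ` of `Ω_δ` from `a_δ` to `b_δ`, some component of `Ω_δ ∖ Γ_δ^ξ` has more
than `1/√δ` sites (`hasLargeHole_of_filament` applied to the filament `cuspFil δ` of
`cuspN δ > √(10/δ) - 1` sites). [cite: DuminilCopinKozmaYadin2014, §1 (after Theorem 1) and Theorem 6] -/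
theorem hasLargeHole_cuspDomain (M : ℕ) (hM : 1 ≤ M) {ξ : ℝ} (hξM : ξ ≤ M) {δ : ℝ} (hδ : 0 < δ)
    (hδ20 : δ ≤ 1 / 20) (hδM : δ * (M : ℝ) ^ 2 ≤ 4) {a b : ℂ} (ha : ‖a‖ = 1) (hb : ‖b‖ = 1)
    {u v : Site 2} (hu : IsClosestSite cuspDomain δ a u) (hv : IsClosestSite cuspDomain δ b v)
    (γ : DomainSAW cuspDomain δ u v) : HasLargeHole ξ (1 / Real.sqrt δ) γ := by
  have hδ25 : δ ≤ 2 / 5 := by linarith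
  have hδ10 : δ < 1 / 10 := by linarith
  have hsδ : 0 < Real.sqrt δ := Real.sqrt_pos.2 hδ
  -- the size of the filament beyond the tube: `N + 1 - M > 1/√δ`
  have hN := sqrt_sub_one_lt_cuspN hδ hδ25
  have h3 : 3 / Real.sqrt δ ≤ Real.sqrt (10 / δ) := by
    rw [Real.le_sqrt (by positivity) (by positivity), div_pow, Real.sq_sqrt hδ.le]
    rw [div_le_div_iff₀ hδ hδ]; nlinarith
  have hM2 : (M : ℝ) ≤ 2 / Real.sqrt δ := by
    rw [le_div_iff₀ hsδ]
    have h1 : ((M : ℝ) * Real.sqrt δ) ^ 2 ≤ 2 ^ 2 := by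
      rw [mul_pow, Real.sq_sqrt hδ.le]; linarith
    exact (pow_le_pow_iff_left₀ (by positivity) (by norm_num) two_ne_zero).1 h1
  have h1δ : 1 < 1 / Real.sqrt δ := by
    rw [lt_div_iff₀ hsδ, one_mul, Real.sqrt_lt' one_pos]; linarith
  have hsplit : 3 / Real.sqrt δ = 1 / Real.sqrt δ + 2 / Real.sqrt δ := by ring
  have hMN : M ≤ cuspN δ := by
    have : (M : ℝ) < cuspN δ := by linarith
    exact_mod_cast this.le
  have hcast : (((cuspN δ + 1 - M : ℕ) : ℕ) : ℝ) = (cuspN δ : ℝ) + 1 - M := by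
    rw [Nat.cast_sub (by omega), Nat.cast_add, Nat.cast_one]
  have hs : 1 / Real.sqrt δ < (((cuspN δ + 1 - M : ℕ) : ℕ) : ℝ) := by
    rw [hcast]; linarith
  exact hasLargeHole_of_filament (meshDomain_finite isBounded_cuspDomain hδ)
    (fun u hu v hv => reachable_discreteDomainGraph_cuspDomain hδ hu hv) (cuspFil δ) (cuspN δ)
    (fun j hj1 hjN => cuspFil_mem_meshDomain hδ hδ25 hj1 hjN)
    (fun j hj1 hjN => cuspFil_adj hδ hδ25 hj1 hjN)
    (fun i j _ _ _ _ h => cuspFil_injective δ h)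
    (fun j hj1 _ w hw => cuspFil_neighbours hδ hδ10 hj1 hw) hu.1
    (fun j hj1 _ => cuspFil_ne_of_isClosestSite hδ hδ20 ha hu hj1)
    (fun j hj1 _ => cuspFil_ne_of_isClosestSite hδ hδ20 hb hv hj1) M hM hξM hMN hs γ

/-! ### The law: the hole event has probability one -/

/-- The support of a SAW of `Ω_δ` determines it. [folklore] -/
theorem walk_support_injective {Ω : Set ℂ} {δ : ℝ} {u v : Site 2} :
    Function.Injective fun γ : DomainSAW Ω δ u v => γ.walk.support := by
  rintro ⟨p, hp⟩ ⟨q, hq⟩ h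
  simp only at h
  have := SimpleGraph.Walk.support_injective h
  subst this
  rfl

/-- For a bounded domain, a positive mesh and a starting site of `Ω_δ`, there are finitely many
SAWs of `Ω_δ` between two given sites (their supports are duplicate-free lists of sites of the
finite set `Ω_δ`, of length at most `|Ω_δ|`). [folklore] -/
theorem finite_domainSAW_of_isBounded {Ω : Set ℂ} {δ : ℝ} (hΩ : Bornology.IsBounded Ω) (hδ : 0 < δ)
    {u v : Site 2} (hu : u ∈ meshDomain Ω δ) : Finite (DomainSAW Ω δ u v) := by
  classical
  have hfin := meshDomain_finite hΩ hδ
  haveI : Fintype ↥(meshDomain Ω δ) := hfin.fintype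
  -- supports, as lists over the finite vertex type of `Ω_δ`, of bounded length
  have hsupp : ∀ (γ : DomainSAW Ω δ u v), ∀ w ∈ γ.walk.support, w ∈ meshDomain Ω δ := by
    intro γ
    have key : ∀ {a b : Site 2} (p : (discreteDomainGraph Ω δ).Walk a b),
        a ∈ meshDomain Ω δ → ∀ w ∈ p.support, w ∈ meshDomain Ω δ := by
      intro a b p
      induction p with
      | nil =>
        intro ha w hw
        rw [SimpleGraph.Walk.support_nil, List.mem_singleton] at hw
        exact hw ▸ ha
      | cons h p ih =>
        intro ha w hw
        rw [SimpleGraph.Walk.support_cons, List.mem_cons] at hw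
        rcases hw with rfl | hw
        · exact ha
        · exact ih (discreteDomainGraph_adj_iff.1 h).2.2 w hw
    exact key γ.walk hu
  let f : DomainSAW Ω δ u v → {l : List ↥(meshDomain Ω δ) // l.length ≤ Fintype.card ↥(meshDomain Ω δ)} :=
    fun γ => ⟨γ.walk.support.pmap (fun w hw => ⟨w, hw⟩) (hsupp γ), by
      rw [List.length_pmap]
      have hnd : (γ.walk.support.pmap (fun w hw => (⟨w, hw⟩ : ↥(meshDomain Ω δ))) (hsupp γ)).Nodup := by
        refine (List.Nodup.pmap ?_ γ.isPath.support_nodup)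
        intro a ha b hb h
        exact congrArg Subtype.val h
      have := hnd.length_le_card
      rwa [List.length_pmap] at this⟩
  haveI : Finite {l : List ↥(meshDomain Ω δ) // l.length ≤ Fintype.card ↥(meshDomain Ω δ)} :=
    (List.finite_length_le _ _).to_subtype
  refine Finite.of_injective f fun γ γ' h => ?_
  apply walk_support_injective
  have h' := congrArg (fun l : {l : List ↥(meshDomain Ω δ) // _} => l.1.map Subtype.val) h
  simpa [f, List.map_pmap] using h'

/-- The weight of a single SAW is `x^{|γ|}`. [cite: DuminilCopinKozmaYadin2014, §1 (definition of P_{(Ω_δ,a_δ,b_δ,x)})] -/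
theorem weightAt_singleton {Ω : Set ℂ} {δ : ℝ} {u v : Site 2} (x : ℝ) (γ : DomainSAW Ω δ u v) :
    weightAt x Ω δ u v {γ} = ENNReal.ofReal (x ^ γ.length) := by
  rw [weightAt, Measure.sum_apply _ MeasurableSpace.measurableSet_top, tsum_eq_single γ]
  · simp
  · intro γ' hγ'
    simp [hγ']

/-- **For the cusp domain the law `P_{(Ω_δ, a_δ, b_δ, x)}` is a probability measure** (`x > 0`,
`δ > 0`, sites of `Ω_δ`): the partition function is positive (the two sites are joined in
`Ω_δ`, so some SAW exists) and finite (finitely many SAWs). [cite: DuminilCopinKozmaYadin2014, §1 (definition of P_{(Ω_δ,a_δ,b_δ,x)})] -/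
theorem lawAt_cuspDomain_univ {x δ : ℝ} (hx : 0 < x) (hδ : 0 < δ) {u v : Site 2}
    (hu : u ∈ meshDomain cuspDomain δ) (hv : v ∈ meshDomain cuspDomain δ) :
    lawAt x cuspDomain δ u v Set.univ = 1 := by
  classical
  haveI := finite_domainSAW_of_isBounded isBounded_cuspDomain hδ hu (v := v)
  haveI : Fintype (DomainSAW cuspDomain δ u v) := Fintype.ofFinite _
  -- the partition function is finite …
  have htop : weightAt x cuspDomain δ u v Set.univ ≠ ⊤ := by
    rw [weightAt, Measure.sum_apply _ MeasurableSpace.measurableSet_top, tsum_fintype]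
    refine ENNReal.sum_ne_top.2 fun γ _ => ?_
    simp
  -- … and positive: there is a SAW from `u` to `v`
  obtain ⟨p⟩ := reachable_discreteDomainGraph_cuspDomain hδ hu hv
  let γ₀ : DomainSAW cuspDomain δ u v := ⟨p.toPath, p.toPath.2⟩
  have hpos : weightAt x cuspDomain δ u v Set.univ ≠ 0 := by
    intro h0
    have h1 : weightAt x cuspDomain δ u v {γ₀} ≤ weightAt x cuspDomain δ u v Set.univ :=
      measure_mono (Set.subset_univ _)
    rw [h0, weightAt_singleton, nonpos_iff_eq_zero, ENNReal.ofReal_eq_zero] at h1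
    have : 0 < x ^ γ₀.length := pow_pos hx _
    linarith
  rw [lawAt, Measure.smul_apply, smul_eq_mul, ENNReal.inv_mul_cancel hpos htop]

/-- Closest sites exist (`Ω_δ` of the cusp domain is finite and contains the origin). [folklore] -/
theorem exists_isClosestSite_cuspDomain {δ : ℝ} (hδ : 0 < δ) (z : ℂ) :
    ∃ w, IsClosestSite cuspDomain δ z w := by
  have hfin := meshDomain_finite isBounded_cuspDomain hδ
  have hne : (meshDomain cuspDomain δ).Nonempty := ⟨0, by
    rw [meshDomain_cuspDomain hδ]
    exact meshVertices_mono unitDisk_subset_cuspDomain δ (zero_mem_meshVertices_unitDisk δ)⟩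
  obtain ⟨w, hw, hmin⟩ := Set.exists_min_image _ (fun w => dist (meshPoint δ w) z) hfin hne
  exact ⟨w, hw, hmin⟩

/-- The points `±i` of the unit circle are boundary points of the cusp domain. [folklore] -/
theorem mem_frontier_cuspDomain {z : ℂ} (hz : ‖z‖ = 1) (hre : z.re ≤ 1 / 2) : z ∈ frontier cuspDomain := by
  rw [frontier]
  refine ⟨?_, ?_⟩
  · refine closure_mono unitDisk_subset_cuspDomain ?_
    rw [unitDisk, closure_ball (0 : ℂ) one_ne_zero, Metric.mem_closedBall, dist_zero_right, hz]
  · intro h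
    rcases interior_subset h with hD | ⟨h1, -, -⟩
    · rw [unitDisk, mem_ball_zero_iff, hz] at hD
      exact lt_irrefl _ hD
    · linarith

/-- The arithmetic of the contradiction: `C t⁴ e^{-ct} < 1` for all large `t` (`c > 0`).
[folklore] -/
theorem eventually_bound_lt_one {c : ℝ} (hc : 0 < c) (C : ℝ) :
    ∀ᶠ t : ℝ in atTop, C * t ^ 4 * Real.exp (-(c * t)) < 1 := by
  have h1 : Tendsto (fun s : ℝ => s ^ 4 * Real.exp (-s)) atTop (𝓝 0) :=
    Real.tendsto_pow_mul_exp_neg_atTop_nhds_zero 4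
  have h2 : Tendsto (fun t : ℝ => c * t) atTop atTop := Tendsto.const_mul_atTop hc tendsto_id
  have h3 := h1.comp h2
  have h4 : Tendsto (fun t : ℝ => C / c ^ 4 * ((c * t) ^ 4 * Real.exp (-(c * t)))) atTop (𝓝 (C / c ^ 4 * 0)) :=
    h3.const_mul _
  rw [mul_zero] at h4
  have h5 := h4.eventually (Iio_mem_nhds one_pos)
  filter_upwards [h5] with t ht
  have : C / c ^ 4 * ((c * t) ^ 4 * Real.exp (-(c * t))) = C * t ^ 4 * Real.exp (-(c * t)) := by
    field_simp
  rwa [this] at ht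

/-- **The printed general-domain Theorem 6 fails for the cusp domain.** For every `x > 0` there
are NO `m`, `ξ ≥ 0`, `c > 0`, `C` such that for every mesh `δ > 0` at which the family of
`m`-boxes of `Ω_δ` is connected, all boundary points `a, b`, all closest sites and all `s > 0`,
`P_{(Ω_δ,a_δ,b_δ,x)}[some component of Ω_δ ∖ Γ_δ^ξ has more than s sites] ≤ (C/δ²) e^{-cs}` —
the literal content of "Theorem 6. For every `x > 1/μ`, there exists `m = m(x)` and `c(x) > 0`
such that for every domain `Ω` and every `δ > 0` such that `𝓕(Ω_δ, m)` is connected, one has,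
for every `a` and `b` in the boundary of `Ω`, and every `λ > 0`,
`P_{Ω_δ,a_δ,b_δ,x}(∃ a component of Ω_δ ∖ Γ_δ^{6m} of size > λ) ≤ (C(x,Ω)/δ²) e^{-c(x)λ}`"
specialised to `Ω =` the cusp domain (with the tube radius `6m` relaxed to any constant `ξ ≥ 0`): for
small `δ = 1/t²` the box family is connected (`boxFamily_cuspDomain_preconnected`), the event has
probability one (`hasLargeHole_cuspDomain`, `lawAt_cuspDomain_univ`) at `s = t = 1/√δ`, while
`(C/δ²) e^{-c/√δ} = C t⁴ e^{-ct} < 1`. The disk instance (`DKY2014_thm6_disk`, proved in the tree)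
and Theorem 1 are not affected. [cite: DuminilCopinKozmaYadin2014, Theorem 6] -/
theorem not_DKY2014_thm6_print_cuspDomain {x : ℝ} (hx : 0 < x) :
    ¬ ∃ m : ℕ, ∃ ξ : ℝ, 0 ≤ ξ ∧ ∃ c : ℝ, 0 < c ∧ ∃ C : ℝ, ∀ δ : ℝ, 0 < δ →
      ((zdGraph 2).induce (boxFamily cuspDomain δ m)).Preconnected →
      ∀ a b : ℂ, a ∈ frontier cuspDomain → b ∈ frontier cuspDomain →
      ∀ u v : Site 2, IsClosestSite cuspDomain δ a u → IsClosestSite cuspDomain δ b v →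
      ∀ s : ℝ, 0 < s →
        lawAt x cuspDomain δ u v {γ | HasLargeHole ξ s γ} ≤
          ENNReal.ofReal (C / δ ^ 2 * Real.exp (-(c * s))) := by
  rintro ⟨m, ξ, hξ, c, hc, C, H⟩
  -- the tube radius, rounded up (and at least `1`)
  set M : ℕ := max 1 ⌈ξ⌉₊ with hM
  have hM1 : 1 ≤ M := le_max_left _ _
  have hξM : ξ ≤ M := (Nat.le_ceil ξ).trans (by rw [hM]; exact_mod_cast le_max_right _ _)
  -- a large `t`, `δ = 1/t²`
  obtain ⟨T, hT⟩ := Filter.eventually_atTop.1 (eventually_bound_lt_one hc C)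
  set t : ℝ := max T (max (Real.sqrt 20) (max (2 * Real.sqrt ((m : ℝ) + 1)) ((M : ℝ) / 2 + 1))) with ht
  have htT : T ≤ t := le_max_left _ _
  have ht20 : Real.sqrt 20 ≤ t := (le_max_left _ _).trans (le_max_right _ _)
  have htm : 2 * Real.sqrt ((m : ℝ) + 1) ≤ t := ((le_max_left _ _).trans (le_max_right _ _)).trans (le_max_right _ _)
  have htM : (M : ℝ) / 2 + 1 ≤ t := ((le_max_right _ _).trans (le_max_right _ _)).trans (le_max_right _ _)
  have ht0 : 0 < t := lt_of_lt_of_le (Real.sqrt_pos.2 (by norm_num)) ht20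
  set δ : ℝ := 1 / t ^ 2 with hδ
  have hδ0 : 0 < δ := by positivity
  have hsqrt : Real.sqrt δ = 1 / t := by
    rw [hδ, Real.sqrt_div' _ , Real.sqrt_one, Real.sqrt_sq ht0.le]
    exact sq_nonneg _
  have hst : 1 / Real.sqrt δ = t := by rw [hsqrt, one_div_one_div]
  have htδ : t ^ 2 * δ = 1 := by rw [hδ]; field_simp
  -- the smallness conditions on `δ`
  have hδ20 : δ ≤ 1 / 20 := by
    rw [hδ, div_le_div_iff₀ (by positivity) (by norm_num), one_mul, one_mul]
    have h := Real.sq_sqrt (show (0 : ℝ) ≤ 20 by norm_num)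
    nlinarith [Real.sqrt_nonneg 20]
  have hδm : 4 * ((m : ℝ) + 1) * δ ≤ 1 := by
    have h := Real.sq_sqrt (show (0 : ℝ) ≤ (m : ℝ) + 1 by positivity)
    have h2 : 4 * ((m : ℝ) + 1) ≤ t ^ 2 := by nlinarith [Real.sqrt_nonneg ((m : ℝ) + 1)]
    calc 4 * ((m : ℝ) + 1) * δ ≤ t ^ 2 * δ := mul_le_mul_of_nonneg_right h2 hδ0.le
      _ = 1 := htδ
  have hδM : δ * (M : ℝ) ^ 2 ≤ 4 := by
    have h2 : (M : ℝ) ^ 2 ≤ 4 * t ^ 2 := by nlinarith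
    calc δ * (M : ℝ) ^ 2 ≤ δ * (4 * t ^ 2) := mul_le_mul_of_nonneg_left h2 hδ0.le
      _ = 4 := by rw [hδ]; field_simp
  -- endpoints and closest sites
  have hI : ‖(Complex.I : ℂ)‖ = 1 := Complex.norm_I
  have hnI : ‖(-Complex.I : ℂ)‖ = 1 := by rw [norm_neg, Complex.norm_I]
  obtain ⟨u, hu⟩ := exists_isClosestSite_cuspDomain hδ0 Complex.I
  obtain ⟨v, hv⟩ := exists_isClosestSite_cuspDomain hδ0 (-Complex.I)
  have hevent : {γ : DomainSAW cuspDomain δ u v | HasLargeHole ξ (1 / Real.sqrt δ) γ} = Set.univ :=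
    Set.eq_univ_of_forall fun γ => hasLargeHole_cuspDomain M hM1 hξM hδ0 hδ20 hδM hI hnI hu hv γ
  have hP := H δ hδ0 (boxFamily_cuspDomain_preconnected hδ0 hδm) Complex.I (-Complex.I)
    (mem_frontier_cuspDomain hI (by simp)) (mem_frontier_cuspDomain hnI (by simp)) u v hu hv
    (1 / Real.sqrt δ) (by positivity)
  rw [hevent, lawAt_cuspDomain_univ hx hδ0 hu.1 hv.1, hst] at hP
  -- `1 ≤ C t⁴ e^{-ct} < 1`
  have hlt := hT t htT
  have hC : C / δ ^ 2 = C * t ^ 4 := by rw [hδ]; field_simp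
  rw [hC] at hP
  have := ENNReal.one_le_ofReal.1 hP
  linarith

end SupercriticalSAW

end Literature.Barriers.CriticalPhenomena
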